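import Mathlib
import HarnessLib
import Literature.Analysis.FluidPDE.TsaiLocalEnergy
import Summits.NavierStokesRegularity.NavierStokesRegularity.Theorems.PoloidalWindowRigidity.Negative.SemiEllipticColumn

/-!
# Crux K2 `PoloidalWindowRigidity` (stmt-NavierStokesRegularity-19708) — negative lemma: `stub_semiEllipticThick` of
# skeleton mixed_type v2 (sha16 0ad8e9d72766f0e2) is FALSE WITHOUT the Oseen-mild hypothesis (M)

Negative-side lemma (refuter seat ns-regularity-refuter1, KILLSHEET K-52; D-0081 §C).  Skeleton mixed_type v2
(`Cruxes/PoloidalWindowRigidity/Lines/mixed_type.lean`) re-types the elliptic research residue of K2 as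
`stub_semiEllipticThick`: class (R)(C)(M)(D)(P) and, on a non-empty open window `W`, non-degeneracy + the time-only slope
pin + twisting, with `W` inside a time slab `(a, b) × ℝ³` EVERY slice of which is SEMI-ELLIPTIC at EVERY point
(`∂₂v₀·∂₀v₂ + ∂₂v₁·∂₁v₂ ≥ 0` on all of `ℝ³`), plus the THICK clause (the shear slope is a function of `(t, x₂)` on NO
non-empty open sub-window) ⇒ `¬ IsBackwardSingularPoint v 0`.  Its docstring asserts that the stub «consumes (M)»; every
(M)-free witness of the tree so far is HYPERBOLIC, and none can be repaired cheaply: by the kinematic identity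
`∂₂vₕ·∇ₕv₂ + (∂₂v₂)² = div (v₂ ∂₂v)` (divergence-free `v`) no space-periodic or decaying field with `∂₂v₂ ≢ 0` is
semi-elliptic everywhere.

THIS FILE supplies the (M)-free witness ON THE SEMI-ELLIPTIC THICK STRATUM: the statement of `stub_semiEllipticThick` with
(M) deleted — everything else VERBATIM — is false (`semiEllipticThick_false_without_mild`), and stays false with the slab
hypothesis strengthened to STRICT ellipticity at every point of every backward slice (`ellipticThick_false_without_mild`).
Witness: the semi-elliptic thick column `…Negative.seProfile`,
  `v(t, x) = (−t)^{-1/2}(arctan x₂ + ερ(x₀)ρ'(x₂), 0, 1 + arctan x₀ + arctan x₁ − ερ'(x₀)ρ(x₂))`, `ρ = 1/(1+h²)`, `ε = 1/8`,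
on `…seWindow = (−1,0) × {1 < x₀ < 2, 1 < x₂ < 2}`: type scalar `(−t)^{-1}(ρ(x₂)+ερ(x₀)ρ''(x₂))(ρ(x₀)−ερ''(x₀)ρ(x₂)) > 0`
EVERYWHERE (the far field `arctan x₀ + arctan x₁` carries the net flux the identity demands), no shear slope at any point
(`∂₂v₁ = 0 < ∂₁v₂` forces `μ = 0`, contradicting `∂₂v₀ > 0`: pin and THICK clause hold), twist bracket
`ε(−t)^{-1}(−ρ'(x₂))ρ''(x₀)ρ(x₁) > 0` on the window, `curl v ≠ 0` everywhere, and `v(t, 0) = (0, 0, (−t)^{-1/2})` makes the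
apex backward-singular.  Companions: `…Negative.HyperbolicThickFalseWithoutMild` (`stub_hyperbolicThick` ∖ (M); v2's stub is
v1's verbatim, so it still applies), `…Negative.TwistingFalseWithoutMild` (lrc-jet `stub_twisting` ∖ (M)).
WHAT THIS IS NOT: not a claim about Navier–Stokes regularity and not a refutation of K2 (whose class includes (M)) — a
kernel-checked record of which hypothesis of the residual stub is load-bearing. [folklore]
-/

noncomputable section

-- the summit and its single sub-problem share the name (CONVENTIONS §1), as in every Theorems file
set_option linter.dupNamespace false

namespace Summit.NavierStokesRegularity.NavierStokesRegularity.Theorems.PoloidalWindowRigidity.Negative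

open MeasureTheory Set Function Filter Topology Metric
open scoped RealInnerProductSpace InnerProductSpace
open Literature.Analysis Literature.Analysis.FluidPDE

local notation "E3" => EuclideanSpace ℝ (Fin 3)
local notation "𝐞" i => (EuclideanSpace.single (i : Fin 3) (1 : ℝ) : EuclideanSpace ℝ (Fin 3))

/-! ## The apex is backward-singular -/

/-- The vertical velocity: `v₂(t, x) = (−t)^{-1/2}(1 + arctan x₀ + arctan x₁ − ερ₁(x₀)ρ(x₂))`. [folklore] -/
theorem seProfile_apply_two (t : ℝ) (x : E3) :
    seProfile t x 2 = cellAmp t * (1 + Real.arctan (x 0) + Real.arctan (x 1) - seEps * (seRho₁ (x 0) * seRho (x 2))) := by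
  simp only [seProfile, PiLp.smul_apply, smul_eq_mul, seField_apply_two]

/-- **The column profile is backward-singular at the apex**: `v(t, 0) = (0, 0, (−t)^{-1/2})` exceeds every level for
`t → 0⁻`, and continuity gives essential unboundedness on every parabolic cylinder `Q_r(0, 0)`
(`isBackwardSingularPoint_of_forall_exists_continuousAt`). [folklore] -/
theorem isBackwardSingularPoint_seProfile : IsBackwardSingularPoint seProfile 0 := by
  apply isBackwardSingularPoint_of_forall_exists_continuousAt
  intro r hr M
  set K : ℝ := |M| + 1 with hKdef
  have hK : 0 < K := by positivity
  have hMK : M < K := by rw [hKdef]; linarith [le_abs_self M]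
  set τ : ℝ := min (r ^ 2 / 2) ((1 / (3 * K)) ^ 2 / 2) with hτdef
  have h3K : 0 < 1 / (3 * K) := by positivity
  have hτpos : 0 < τ := lt_min (by positivity) (by positivity)
  have hτr : τ < r ^ 2 := lt_of_le_of_lt (min_le_left _ _) (by nlinarith)
  have hτK : τ < (1 / (3 * K)) ^ 2 := lt_of_le_of_lt (min_le_right _ _) (by nlinarith)
  have hsqrt : Real.sqrt τ < 1 / (3 * K) := by
    rw [Real.sqrt_lt' h3K]
    exact hτK
  have hsqrtpos : 0 < Real.sqrt τ := Real.sqrt_pos.2 hτpos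
  have hamp : cellAmp (-τ) = (Real.sqrt τ)⁻¹ := by simp [cellAmp]
  refine ⟨((-τ : ℝ), (0 : E3)), ?_, ?_, ?_⟩
  · rw [mem_parabolicCylinder]
    refine ⟨⟨?_, ?_⟩, ?_⟩
    · simp only [Prod.fst_zero]; linarith
    · simp only [Prod.fst_zero]; linarith
    · simp only [Prod.snd_zero, dist_self]; exact hr
  · exact continuousOn_seProfile.continuousAt
      ((isOpen_Iio.prod isOpen_univ).mem_nhds ⟨by simp [hτpos], Set.mem_univ _⟩)
  · have hcomp : seProfile (-τ) 0 2 = (Real.sqrt τ)⁻¹ * 1 := by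
      rw [seProfile_apply_two, hamp, PiLp.zero_apply, PiLp.zero_apply, Real.arctan_zero, seRho₁_zero]
      ring
    have hlow : (Real.sqrt τ)⁻¹ * 1 ≤ ‖seProfile (-τ) 0‖ := by
      calc (Real.sqrt τ)⁻¹ * 1 = |seProfile (-τ) 0 2| := by
            rw [hcomp, abs_of_nonneg]
            positivity
        _ = ‖seProfile (-τ) 0 2‖ := (Real.norm_eq_abs _).symm
        _ ≤ ‖seProfile (-τ) 0‖ := PiLp.norm_apply_le _ 2
    have hKlt : K < (Real.sqrt τ)⁻¹ * (1 / 3) := by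
      rw [← div_eq_inv_mul, lt_div_iff₀ hsqrtpos]
      calc K * Real.sqrt τ < K * (1 / (3 * K)) := mul_lt_mul_of_pos_left hsqrt hK
        _ = 1 / 3 := by field_simp
    have hmono : (Real.sqrt τ)⁻¹ * (1 / 3) ≤ (Real.sqrt τ)⁻¹ * 1 :=
      mul_le_mul_of_nonneg_left (by norm_num) (inv_nonneg.2 (Real.sqrt_nonneg _))
    show M < ‖seProfile (-τ) 0‖
    linarith

/-! ## The negative lemma -/

/-- **`stub_semiEllipticThick` of skeleton mixed_type v2 is FALSE without the Oseen-mild identity (M).**  The hypotheses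
are those of `stub_semiEllipticThick` VERBATIM with (M) deleted; the semi-elliptic thick column (`C = 10`, window
`seWindow`, slab `(a, b) = (−1, 0)`) satisfies all of them — non-degenerate, time-only pin and THICK clause (no slope exists
at any point), twisting, every slice of the slab (indeed every slice) semi-elliptic at every point of `ℝ³` (indeed
STRICTLY elliptic for `t < 0`) — and is backward-singular at the apex.  So the elliptic residue of K2, like the hyperbolic
one (`hyperbolicThick_false_without_mild`), does not survive deletion of (M): any proof of `stub_semiEllipticThick` must
use the Oseen identity (possibly already through the frozen-vorticity law or slice analyticity it implies).  By the
kinematic identity `∂₂vₕ·∇ₕv₂ + (∂₂v₂)² = div (v₂ ∂₂v)` every space-periodic or decaying (M)-free witness is excluded from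
this stratum — the column here has the non-periodic far field `arctan x₀ + arctan x₁` carrying the required net flux.
[folklore] -/
theorem semiEllipticThick_false_without_mild :
    ¬ (∀ (C : ℝ) (v : ℝ → EuclideanSpace ℝ (Fin 3) → EuclideanSpace ℝ (Fin 3)),
      Literature.Analysis.FluidPDE.HasTypeITimeDecay C v →
      ContinuousOn (Function.uncurry v) (Set.Iio (0 : ℝ) ×ˢ Set.univ) →
      (∀ t < 0, Literature.Analysis.FluidPDE.VectorCalculus.IsDivFree (v t)) →
      (∀ s < 0, ∀ y, ⟪Literature.Analysis.FluidPDE.curl (v s) y, EuclideanSpace.single 2 1⟫_ℝ = 0) →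
      ∀ W : Set (ℝ × EuclideanSpace ℝ (Fin 3)), IsOpen W → W.Nonempty → W ⊆ Set.Iio (0 : ℝ) ×ˢ Set.univ →
        (∀ z ∈ W, Literature.Analysis.FluidPDE.curl (v z.1) z.2 ≠ 0 ∧
          (fderiv ℝ (v z.1) z.2 (EuclideanSpace.single 0 1) 2 ≠ 0 ∨ fderiv ℝ (v z.1) z.2 (EuclideanSpace.single 1 1) 2 ≠ 0) ∧
          (fderiv ℝ (v z.1) z.2 (EuclideanSpace.single 2 1) 0 ≠ 0 ∨ fderiv ℝ (v z.1) z.2 (EuclideanSpace.single 2 1) 1 ≠ 0)) →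
        (∀ m : ℝ → ℝ, ∀ W₁ : Set (ℝ × EuclideanSpace ℝ (Fin 3)), W₁ ⊆ W → IsOpen W₁ → W₁.Nonempty →
          ∃ z ∈ W₁, ∃ b : Fin 3, b ≠ 2 ∧
            fderiv ℝ (v z.1) z.2 (EuclideanSpace.single 2 1) b ≠
              m z.1 * fderiv ℝ (v z.1) z.2 (EuclideanSpace.single b 1) 2) →
        (∀ z ∈ W,
          fderiv ℝ (fun x => fderiv ℝ (v z.1) x (EuclideanSpace.single 2 1) 2) z.2 (EuclideanSpace.single 0 1) *
              fderiv ℝ (v z.1) z.2 (EuclideanSpace.single 1 1) 2 -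
            fderiv ℝ (fun x => fderiv ℝ (v z.1) x (EuclideanSpace.single 2 1) 2) z.2 (EuclideanSpace.single 1 1) *
              fderiv ℝ (v z.1) z.2 (EuclideanSpace.single 0 1) 2 ≠ 0) →
        ∀ a b : ℝ, W ⊆ Set.Ioo a b ×ˢ Set.univ →
          (∀ s ∈ Set.Ioo a b, ∀ y : EuclideanSpace ℝ (Fin 3),
            0 ≤ fderiv ℝ (v s) y (EuclideanSpace.single 2 1) 0 * fderiv ℝ (v s) y (EuclideanSpace.single 0 1) 2 +
              fderiv ℝ (v s) y (EuclideanSpace.single 2 1) 1 * fderiv ℝ (v s) y (EuclideanSpace.single 1 1) 2) →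
        (∀ m : ℝ → ℝ → ℝ, ∀ W₁ : Set (ℝ × EuclideanSpace ℝ (Fin 3)), W₁ ⊆ W → IsOpen W₁ → W₁.Nonempty →
          ∃ z ∈ W₁, ∃ b : Fin 3, b ≠ 2 ∧
            fderiv ℝ (v z.1) z.2 (EuclideanSpace.single 2 1) b ≠
              m z.1 (z.2 2) * fderiv ℝ (v z.1) z.2 (EuclideanSpace.single b 1) 2) →
        ¬ Literature.Analysis.FluidPDE.IsBackwardSingularPoint v 0) := by
  intro H
  exact H 10 seProfile hasTypeITimeDecay_seProfile continuousOn_seProfile (fun t _ => isDivFree_seProfile t)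
    (fun s _ y => poloidal_seProfile s y) seWindow isOpen_seWindow seWindow_nonempty seWindow_subset seProfile_pins
    (fun m W₁ hW₁ _ hW₁n => seProfile_slope_clause_time m W₁ hW₁ hW₁n) seProfile_twist_ne_zero (-1) 0
    seWindow_subset_slab (fun s _ y => seProfile_type_nonneg s y)
    (fun m W₁ hW₁ _ hW₁n => seProfile_slope_clause_timeHeight m W₁ hW₁ hW₁n) isBackwardSingularPoint_seProfile

/-- **… and it stays false with the semi-elliptic slab hypothesis STRENGTHENED to strict ellipticity at every point of
every backward slice** (`∂₂v₀·∂₀v₂ + ∂₂v₁·∂₁v₂ > 0` on all of `(−∞,0) × ℝ³`): uniform-in-space positivity of the type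
scalar is not what (M) contributes. [folklore] -/
theorem ellipticThick_false_without_mild :
    ¬ (∀ (C : ℝ) (v : ℝ → EuclideanSpace ℝ (Fin 3) → EuclideanSpace ℝ (Fin 3)),
      Literature.Analysis.FluidPDE.HasTypeITimeDecay C v →
      ContinuousOn (Function.uncurry v) (Set.Iio (0 : ℝ) ×ˢ Set.univ) →
      (∀ t < 0, Literature.Analysis.FluidPDE.VectorCalculus.IsDivFree (v t)) →
      (∀ s < 0, ∀ y, ⟪Literature.Analysis.FluidPDE.curl (v s) y, EuclideanSpace.single 2 1⟫_ℝ = 0) →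
      ∀ W : Set (ℝ × EuclideanSpace ℝ (Fin 3)), IsOpen W → W.Nonempty → W ⊆ Set.Iio (0 : ℝ) ×ˢ Set.univ →
        (∀ z ∈ W, Literature.Analysis.FluidPDE.curl (v z.1) z.2 ≠ 0 ∧
          (fderiv ℝ (v z.1) z.2 (EuclideanSpace.single 0 1) 2 ≠ 0 ∨ fderiv ℝ (v z.1) z.2 (EuclideanSpace.single 1 1) 2 ≠ 0) ∧
          (fderiv ℝ (v z.1) z.2 (EuclideanSpace.single 2 1) 0 ≠ 0 ∨ fderiv ℝ (v z.1) z.2 (EuclideanSpace.single 2 1) 1 ≠ 0)) →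
        (∀ m : ℝ → ℝ, ∀ W₁ : Set (ℝ × EuclideanSpace ℝ (Fin 3)), W₁ ⊆ W → IsOpen W₁ → W₁.Nonempty →
          ∃ z ∈ W₁, ∃ b : Fin 3, b ≠ 2 ∧
            fderiv ℝ (v z.1) z.2 (EuclideanSpace.single 2 1) b ≠
              m z.1 * fderiv ℝ (v z.1) z.2 (EuclideanSpace.single b 1) 2) →
        (∀ z ∈ W,
          fderiv ℝ (fun x => fderiv ℝ (v z.1) x (EuclideanSpace.single 2 1) 2) z.2 (EuclideanSpace.single 0 1) *
              fderiv ℝ (v z.1) z.2 (EuclideanSpace.single 1 1) 2 -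
            fderiv ℝ (fun x => fderiv ℝ (v z.1) x (EuclideanSpace.single 2 1) 2) z.2 (EuclideanSpace.single 1 1) *
              fderiv ℝ (v z.1) z.2 (EuclideanSpace.single 0 1) 2 ≠ 0) →
        (∀ s < 0, ∀ y : EuclideanSpace ℝ (Fin 3),
            0 < fderiv ℝ (v s) y (EuclideanSpace.single 2 1) 0 * fderiv ℝ (v s) y (EuclideanSpace.single 0 1) 2 +
              fderiv ℝ (v s) y (EuclideanSpace.single 2 1) 1 * fderiv ℝ (v s) y (EuclideanSpace.single 1 1) 2) →
        (∀ m : ℝ → ℝ → ℝ, ∀ W₁ : Set (ℝ × EuclideanSpace ℝ (Fin 3)), W₁ ⊆ W → IsOpen W₁ → W₁.Nonempty →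
          ∃ z ∈ W₁, ∃ b : Fin 3, b ≠ 2 ∧
            fderiv ℝ (v z.1) z.2 (EuclideanSpace.single 2 1) b ≠
              m z.1 (z.2 2) * fderiv ℝ (v z.1) z.2 (EuclideanSpace.single b 1) 2) →
        ¬ Literature.Analysis.FluidPDE.IsBackwardSingularPoint v 0) := by
  intro H
  exact H 10 seProfile hasTypeITimeDecay_seProfile continuousOn_seProfile (fun t _ => isDivFree_seProfile t)
    (fun s _ y => poloidal_seProfile s y) seWindow isOpen_seWindow seWindow_nonempty seWindow_subset seProfile_pins
    (fun m W₁ hW₁ _ hW₁n => seProfile_slope_clause_time m W₁ hW₁ hW₁n) seProfile_twist_ne_zero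
    (fun s hs y => seProfile_type_pos hs y)
    (fun m W₁ hW₁ _ hW₁n => seProfile_slope_clause_timeHeight m W₁ hW₁ hW₁n) isBackwardSingularPoint_seProfile

end Summit.NavierStokesRegularity.NavierStokesRegularity.Theorems.PoloidalWindowRigidity.Negative

end
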